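/-
Copyright: harness tree, Literature layer (sorry-free). b2b-lace enum2-g12 (ENUMERATION SHARD B gen 12),
GAPS G8 (δ2)(i), SEEDCERT_U L4 — the coefficient-list interface for the certificate instances (M3).
-/
import Literature.Probability.LatticeModels.SRWHeatKernelBracketEps
import Literature.Probability.LatticeModels.SRWHeatKernelBracketCoeffs
import HarnessLib

/-!
# The large-`u` bracket with an explicit coefficient list

`SRWHeatKernelBracketEps.srwHeatKernel_bracket_eps` is stated with the coefficients
`g_i = bracketCoeff m J i` of the (noncomputable) real polynomial `Pg = T_m(1-2y) B_J(y)` and the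
summation range `bracketDeg m J`.  A certificate instance (fixed `a = |m| ≤ 6`, `J`, `s₀`, `T`) wants
to supply the coefficients as an explicit list of rationals `c₀,…,c_{N-1}` and to verify only the
polynomial IDENTITY `T_m(1-2y) B_J(y) = Σ_{i<N} c_i yⁱ` (by `simp [T_two, …]; ring`).  This file
provides that interface:

* `listPoly_eq_bracketPoly` — a polynomial identity on `ℝ` identifies the bookkeeping polynomial
  `listPoly c N` (from `SRWHeatKernelBracketCoeffs`) with `Pg`;
* `sum_bracketCoeff_eq_of_eval` — if `∀ y, T_m(1-2y) B_J(y) = Σ_{i<N} c_i yⁱ` then for every weight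
  `a` and every `F` with `F 0 = 0`, `Σ_{i<bracketDeg} F(g_i) a_i = Σ_{i<N} F(c_i) a_i`
  (two polynomials agreeing on `ℝ` have the same coefficients);
* `srwHeatKernel_bracket_eps_of_eval` — the certificate form of the bracket with `(N, c)` in place
  of `(bracketDeg, bracketCoeff)`: for `0 < s₀ < 1`, `T ≥ (J+3/2)/(2s₀²)`, `u ≥ T`,
  `|√(2πu) q_u(m) - Σ_{i<N} c_i (2i-1)‼/(4u)ⁱ| ≤ ε_c (u^{J+1})⁻¹`,
  `ε_c = β_{J+1}/(1-s₀²)(2J+1)‼/4^{J+1} + √(2π) e^{-2Ts₀²} T^{J+3/2}(1 + (2/π)Σ_{i<N}|c_i| (2s₀)^{-1} complSum i s₀² (2T))`;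
* `srwHeatKernel_bracket_eps_coeffQ` — the same with the COMPUTABLE rational coefficients
  `c_i = bracketCoeffQ |m| J i`, `N = |m| + J + 1` of `SRWHeatKernelBracketCoeffs` (no hypothesis left:
  a certificate instance only evaluates rationals).

References: R. Fitzner, R. van der Hofstad, Electron. J. Probab. 22 (2017), §5.1.1 (5.2)–(5.5),
pp. 1089–1090. [cite: FitznerVanDerHofstad2016NoBLE, §5.1.1 (5.2)-(5.5) p. 1089-1090];
T. Hara, G. Slade, Rev. Math. Phys. 4 (1992), Appendix B. [cite: HaraSlade1992b, Appendix B]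
-/

noncomputable section

open Real MeasureTheory Set Finset Polynomial Polynomial.Chebyshev
open Literature.Probability.FitznerVanDerHofstad2017
open scoped Nat

namespace Literature.Probability.LatticeModels

/-- A polynomial identity on `ℝ` identifies `listPoly c N` with `Pg`. [folklore] -/
theorem listPoly_eq_bracketPoly {m : ℤ} {J N : ℕ} {c : ℕ → ℝ}
    (hc : ∀ y : ℝ, (T ℝ m).eval (1 - 2 * y) * invSqrtPartial J y = ∑ i ∈ range N, c i * y ^ i) :
    listPoly c N = bracketPoly m J := by
  apply Polynomial.eq_of_infinite_eval_eq
  have h : {x : ℝ | eval x (listPoly c N) = eval x (bracketPoly m J)} = Set.univ := by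
    ext y
    simp only [Set.mem_setOf_eq, Set.mem_univ, iff_true]
    rw [eval_listPoly, eval_bracketPoly, hc]
  rw [h]
  exact Set.infinite_univ

/-- **Coefficient transfer.**  If `T_m(1-2y) B_J(y) = Σ_{i<N} c_i yⁱ` for all real `y`, then for every
weight `a : ℕ → ℝ` and every `F` with `F 0 = 0`:
`Σ_{i<bracketDeg} F(g_i) a_i = Σ_{i<N} F(c_i) a_i`. [folklore] -/
theorem sum_bracketCoeff_eq_of_eval {m : ℤ} {J N : ℕ} {c : ℕ → ℝ}
    (hc : ∀ y : ℝ, (T ℝ m).eval (1 - 2 * y) * invSqrtPartial J y = ∑ i ∈ range N, c i * y ^ i)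
    (F : ℝ → ℝ) (hF : F 0 = 0) (a : ℕ → ℝ) :
    ∑ i ∈ range (bracketDeg m J), F (bracketCoeff m J i) * a i = ∑ i ∈ range N, F (c i) * a i := by
  have hP := listPoly_eq_bracketPoly hc
  -- both sides equal the sum over `range M`, `M = max N (bracketDeg m J)`, of `F(coeff i) a i`
  set M := max N (bracketDeg m J) with hM
  have hcoeff : ∀ i, bracketCoeff m J i = if i < N then c i else 0 := by
    intro i; rw [bracketCoeff, ← hP, coeff_listPoly]
  have hL : ∑ i ∈ range (bracketDeg m J), F (bracketCoeff m J i) * a i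
      = ∑ i ∈ range M, F (bracketCoeff m J i) * a i := by
    refine Finset.sum_subset (Finset.range_mono (le_max_right _ _)) fun i hi hi' => ?_
    have hlt : (bracketPoly m J).natDegree < i := by
      simp only [Finset.mem_range, bracketDeg, not_lt] at hi'
      omega
    rw [bracketCoeff, coeff_eq_zero_of_natDegree_lt hlt, hF, zero_mul]
  have hR : ∑ i ∈ range N, F (c i) * a i = ∑ i ∈ range M, F (bracketCoeff m J i) * a i := by
    rw [show ∑ i ∈ range N, F (c i) * a i = ∑ i ∈ range N, F (bracketCoeff m J i) * a i from
      Finset.sum_congr rfl fun i hi => by rw [hcoeff i, if_pos (Finset.mem_range.1 hi)]]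
    refine Finset.sum_subset (Finset.range_mono (le_max_left _ _)) fun i hi hi' => ?_
    rw [hcoeff i, if_neg (by simpa using hi'), hF, zero_mul]
  rw [hL, hR]

/-- **SEEDCERT L4 with an explicit coefficient list.**  For `0 < s₀ < 1`, `J : ℕ`,
`T ≥ (J+3/2)/(2s₀²)`, `u ≥ T` and any `c₀,…,c_{N-1}` with `T_m(1-2y) B_J(y) = Σ_{i<N} c_i yⁱ` on `ℝ`:
`|√(2πu) q_u(m) - Σ_{i<N} c_i (2i-1)‼/(4u)ⁱ| ≤ ε_c · (u^{J+1})⁻¹` with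
`ε_c = β_{J+1}/(1-s₀²)(2J+1)‼/4^{J+1} + √(2π) e^{-2Ts₀²} T^{J+3/2}(1 + (2/π)Σ_{i<N}|c_i|(2s₀)^{-1} complSum i s₀² (2T))`.
[cite: FitznerVanDerHofstad2016NoBLE, §5.1.1 (5.2)-(5.5) p. 1089-1090] -/
theorem srwHeatKernel_bracket_eps_of_eval {u T₀ s₀ : ℝ} (hs₀0 : 0 < s₀) (hs₀1 : s₀ < 1) (m : ℤ)
    (J : ℕ) (hT : ((J : ℝ) + 3 / 2) / (2 * s₀ ^ 2) ≤ T₀) (hu : T₀ ≤ u) {N : ℕ} {c : ℕ → ℝ}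
    (hc : ∀ y : ℝ, (T ℝ m).eval (1 - 2 * y) * invSqrtPartial J y = ∑ i ∈ range N, c i * y ^ i) :
    |√(2 * π * u) * srwHeatKernel u m - ∑ i ∈ range N, c i * ((2 * i - 1)‼ : ℝ) / (4 * u) ^ i|
      ≤ (invSqrtCoeff (J + 1) / (1 - s₀ ^ 2) * ((2 * J + 1)‼ : ℝ) / 4 ^ (J + 1)
          + √(2 * π) * Real.exp (-(2 * T₀ * s₀ ^ 2)) * T₀ ^ ((J : ℝ) + 3 / 2)
            * (1 + 2 / π * ∑ i ∈ range N, |c i| * (1 / (2 * s₀) * complSum i (s₀ ^ 2) (2 * T₀))))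
        * (u ^ (J + 1))⁻¹ := by
  have h := srwHeatKernel_bracket_eps hs₀0 hs₀1 m J hT hu
  have hmain : ∑ i ∈ range (bracketDeg m J), bracketCoeff m J i * ((2 * i - 1)‼ : ℝ) / (4 * u) ^ i
      = ∑ i ∈ range N, c i * ((2 * i - 1)‼ : ℝ) / (4 * u) ^ i := by
    have e := sum_bracketCoeff_eq_of_eval hc id rfl (fun i => ((2 * i - 1)‼ : ℝ) / (4 * u) ^ i)
    simp only [id_eq] at e
    simpa [mul_div_assoc] using e
  have hS : ∑ i ∈ range (bracketDeg m J), |bracketCoeff m J i|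
        * (1 / (2 * s₀) * complSum i (s₀ ^ 2) (2 * T₀))
      = ∑ i ∈ range N, |c i| * (1 / (2 * s₀) * complSum i (s₀ ^ 2) (2 * T₀)) :=
    sum_bracketCoeff_eq_of_eval hc (fun x => |x|) abs_zero _
  rw [hmain] at h
  rw [bracketEps, hS] at h
  exact h

/-- **SEEDCERT L4 with the computable coefficient list.**  For `0 < s₀ < 1`, `J : ℕ`,
`T₀ ≥ (J+3/2)/(2s₀²)`, `u ≥ T₀`, `m : ℤ`, with `c_i = bracketCoeffQ |m| J i` (rationals) and `N = |m|+J+1`: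
`|√(2πu) q_u(m) - Σ_{i<N} c_i (2i-1)‼/(4u)ⁱ| ≤ ε_c · (u^{J+1})⁻¹`, `ε_c` as in
`srwHeatKernel_bracket_eps_of_eval`. [cite: FitznerVanDerHofstad2016NoBLE, §5.1.1 (5.2)-(5.5) p. 1089-1090] -/
theorem srwHeatKernel_bracket_eps_coeffQ {u T₀ s₀ : ℝ} (hs₀0 : 0 < s₀) (hs₀1 : s₀ < 1) (m : ℤ)
    (J : ℕ) (hT : ((J : ℝ) + 3 / 2) / (2 * s₀ ^ 2) ≤ T₀) (hu : T₀ ≤ u) :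
    |√(2 * π * u) * srwHeatKernel u m
        - ∑ i ∈ range (m.natAbs + J + 1),
            ((bracketCoeffQ m.natAbs J i : ℚ) : ℝ) * ((2 * i - 1)‼ : ℝ) / (4 * u) ^ i|
      ≤ (invSqrtCoeff (J + 1) / (1 - s₀ ^ 2) * ((2 * J + 1)‼ : ℝ) / 4 ^ (J + 1)
          + √(2 * π) * Real.exp (-(2 * T₀ * s₀ ^ 2)) * T₀ ^ ((J : ℝ) + 3 / 2)
            * (1 + 2 / π * ∑ i ∈ range (m.natAbs + J + 1), |((bracketCoeffQ m.natAbs J i : ℚ) : ℝ)|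
                * (1 / (2 * s₀) * complSum i (s₀ ^ 2) (2 * T₀))))
        * (u ^ (J + 1))⁻¹ := by
  refine srwHeatKernel_bracket_eps_of_eval hs₀0 hs₀1 m J hT hu fun y => ?_
  rw [← T_natAbs]
  exact eval_T_mul_invSqrtPartial_eq_sum m.natAbs J y

end Literature.Probability.LatticeModels
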